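import Summits.Schanuel.Schanuel.Theorems.RootDecomp1HWitness
import Summits.Schanuel.Schanuel.Theorems.RootDecomp1HStarLocalisation
import Literature.Barriers.Schanuel.LargeTranscendenceDegree
import Literature.Algebra.Polynomial.JacobianCriterion

/-!
# RootDecomp1H — ROUND 9 «GAUGE», part 1 of 2 (§1 the certificate theorem, §2 certificates at counterexamples and the certificate gauge)

Both parts (`RootDecomp1HGaugeCore` §1–§2, `RootDecomp1HGauge` §3–§5) share the namespace
`Summit.Schanuel.Schanuel.Theorems.RootDecomp1HGauge`; importers use `RootDecomp1HGauge`.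

# RootDecomp1H — GAUGE: every counterexample to Schanuel's conjecture carries a transverse integer certificate;
# the residual `BridgeTransverse` is a gauge inequality (round 9 of route-Schanuel-RootDecomp1H, a THEOREM round;
# supports the declared residual `BridgeTransverse`, stmt-Schanuel-30564, and the instrument `FinCS`, stmt-Schanuel-27287)

Lens-5 cell decomp-schanuel («finite/base range + asymptotic regime + bridge»), generation 9, node `Gauge.lean`.
Nothing here proves Schanuel; the route's item set and its deciding theorem `RootDecomp1H.closes` (rev 14) are untouched.

## What is proved (0 sorry, axioms standard)

§1 **The certificate theorem** (pure algebra, hypothesis-free, `exists_certificate`; the POINT analogue of the step (25)–(26) of the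
Jacobian criterion `Literature.Algebra.Polynomial.JacobianCriterion` (Humphreys § 3.10), whose `notMem_vars_of_pderiv_eq_zero` is reused): if the coordinates of a point
`x ∈ ℂ^ι` lie in an intermediate field of transcendence degree `≤ t` over `ℚ`, then for every `r` with `r + t ≤ |ι|` the point
carries `r` INTEGER polynomial relations `P₁, …, P_r ∈ ℤ[Xᵢ : i ∈ ι]`, `P_k(x) = 0`, whose gradients `(∂ⱼP_k(x))ⱼ` are
`ℂ`-linearly independent.  Proof: a maximal-cardinality algebraically independent set `s` of coordinates has `|s| ≤ t`
(`AlgebraicIndependent.cardinalMk_le_trdeg`); for each `i ∉ s` a rational relation supported on `s ∪ {i}` of LEAST degree in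
`Xᵢ` has `∂ᵢ`-derivative non-vanishing at `x` (else the derivative is a smaller relation of the same kind, or — if it is the zero
polynomial, characteristic `0` — the relation lives on `s`); the family is triangular off `s`, hence gradient-independent;
denominators are cleared by an integer homothety, which rescales each gradient by a unit.

§2 **Certificates at counterexamples** (`exists_certificate_of_counterEx`): every `y ∈ ℂⁿ` with `trdeg ℚ(y, e^y) < n` — in
particular every counterexample to Schanuel's conjecture, first failure or not, on or off the tower hull — carries a TRANSVERSE
INTEGER CERTIFICATE: `n + 1` integer relations on `(y, e^y)` with `ℂ`-independent gradients, i.e. exactly the last two conjuncts of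
the conclusion of `BridgeTransverse`.  Hence the CERTIFICATE GAUGE `certGauge n y` (least size — max of total degree and height —
of such a certificate) is a well-defined natural number at every counterexample (`certGauge_spec`).

§3 **The gauge family and the two ends** (`BridgeAt g`, `FinCSAt g` for a gauge `g : ℕ → ℕ → ℕ`; the live items are the
members `g n c = c + 3`: `bridgeAt_std_iff : BridgeAt stdGauge ↔ BridgeTransverse` and `finCSAt_std_iff : FinCSAt stdGauge ↔ FinCS`,
both `Iff.rfl`): the bridge is monotone and the instrument antitone in `g` (`bridgeAt_mono`, `finCSAt_anti`); at the TOP gauge (no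
size bound) the bridge is a THEOREM (`bridgeTop_holds`, by §2) and the route degenerates to
`closes_top : FirstFailureConjStable → FinCSTop → Schanuel` (the instrument alone carries the summit on the conjugation-stable
cells — the costume end); at every finite gauge the pair (instrument, bridge) is the pair of inequalities
`g n c < certGauge n y` on the cell (`finCSAt_iff_gauge`) versus `certGauge n y ≤ g n c` at the transverse conjugation-stable
near-`c⋆`-optimal first failures (`bridgeAt_iff_gauge`), so `bridgeTransverse_iff_gauge : BridgeTransverse ↔ GaugeBound stdGauge`:
**the residual is exactly the height/degree comparison `N(y) ≤ c⋆(y) + 3` between two integers attached to every first failure**,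
the certificate gauge `N(y)` (finite by §2) and the presentation gauge `c⋆(y)` (finite by `StarLocalisation`).  This answers the
lens question of record («where must the finite range end for the bridge to become provable?»): a finite range `g` carries the
bridge at `(n, c)` iff `g(n, c)` reaches the certificate gauge of every first failure in the cell; no range short of that is
provable by the methods in the tree, and the unbounded range is the summit in costume.

§4 **Span-optimal presentations** (`exists_nearOpt_of_presented`, answering the critic's P1 of round 8): any tuple presented at
some size has a tuple of the SAME SPAN satisfying the first inline hypothesis of `BridgeTransverse` verbatim (near-`c⋆`-optimal,
minimising over all tuples of that span); instantiated at the round-8 witness: `exists_nearOpt_W₃`.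

§5 **A half-rung off the hull** (`two_le_trdeg_W₄`): the conjugation-stable `ℚ`-free rank-4 configuration
`W₄ = (a₀, √2·a₀, i·a₀, i√2·a₀)` (`e^{√2 a₀} = e^{a₀} + 1`, the round-8 root), which lies off the tower hull whenever `W₃` does
(`not_inTowerHull_W₄_of_structural`), has `trdeg ℚ(W₄, e^{W₄}) ≥ 2` — by Theorem 2.9 of LNM 1752 Ch. 14, the named fact
`Literature.Barriers.Schanuel.smallTrdeg_thm_2_9_pos` taken as the hypothesis `h29` exactly as in `RootDecomp1EEStableRung` and
DISCHARGED IN TREE by `Literature.Barriers.Schanuel.smallTrdeg_thm_2_9_pos_holds` (module `LargeTranscendenceDegreeThm29Holds`, not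
imported here to keep this file's import closure inside the built snapshot) — on the grid `x = (a₀, i a₀)`, `y = (1, √2, i)`,
`ℓ + d = 5 < 6 = dℓ`, the field `ℚ(x, y, e^{xᵢyⱼ})` being contained in `ℚ(W₄, e^{W₄})`.  Schanuel predicts `4`; this is the proved reach `t₂ ≥ 2` of the
several-variables method (barrier B3, `LargeTranscendenceDegree`) at an explicit off-hull configuration, recorded as the cell's
first decided inequality about a transverse candidate — not a decided cell.

0 sorry; axioms standard (`propext`, `Classical.choice`, `Quot.sound`).
-/

set_option linter.dupNamespace false

noncomputable section

namespace Summit.Schanuel.Schanuel.Theorems.RootDecomp1HGauge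

open Complex Set
open Literature.NumberTheory.Transcendental (SchanuelRank Khovanskii.ePD)
open Summit.Schanuel.Schanuel.Theses.RootDecomp1H
open Summit.Schanuel.Schanuel.Theorems.RootDecomp1HClearance (LowerRanks CounterEx InTowerHull)
open Summit.Schanuel.Schanuel.Theorems.RootDecomp1HStarLocalisation (starLocalisation_holds)
open Summit.Schanuel.Schanuel.Theorems.RootDecomp1HWitness

/-! ## 1. The certificate theorem (pure algebra) -/

section Certificate

open MvPolynomial

variable {ι : Type}

/-- The variables of `∂ᵢ q` are among those of `q`. -/
theorem vars_pderiv_subset {R : Type*} [CommSemiring R] {q : MvPolynomial ι R} {i : ι} :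
    (pderiv i q).vars ⊆ q.vars := by
  classical
  intro j hj
  rw [mem_vars_iff_mem_support] at hj ⊢
  obtain ⟨m, hm, hjm⟩ := hj
  refine ⟨m + Finsupp.single i 1, ?_, ?_⟩
  · rw [mem_support_iff] at hm ⊢
    rw [coeff_pderiv] at hm
    exact left_ne_zero_of_mul hm
  · rw [Finsupp.mem_support_iff] at hjm ⊢
    simp only [Finsupp.coe_add, Pi.add_apply]
    omega

/-- `∂ᵢ` lowers the degree in `Xᵢ` (when the derivative is non-zero). -/
theorem degreeOf_pderiv_lt {R : Type*} [CommSemiring R] {q : MvPolynomial ι R} {i : ι} (h : pderiv i q ≠ 0) :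
    (pderiv i q).degreeOf i < q.degreeOf i := by
  classical
  obtain ⟨m₀, hm₀⟩ := Finset.nonempty_iff_ne_empty.2 (support_eq_empty.not.2 h)
  have key : ∀ m ∈ (pderiv i q).support, m i + 1 ≤ q.degreeOf i := by
    intro m hm
    have hm' : m + Finsupp.single i 1 ∈ q.support := by
      rw [mem_support_iff] at hm ⊢
      rw [coeff_pderiv] at hm
      exact left_ne_zero_of_mul hm
    have := monomial_le_degreeOf i hm'
    simpa [Finsupp.coe_add, Pi.add_apply, Finsupp.single_eq_same] using this
  have hpos : 0 < q.degreeOf i := lt_of_lt_of_le (Nat.succ_pos _) (key m₀ hm₀)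
  rw [degreeOf_lt_iff hpos]
  intro m hm
  exact Nat.lt_of_succ_le (key m hm)

/-- **Core lemma.** If `x` is algebraically independent on `s` but not on `insert i s`, there is a rational relation
supported on `insert i s`, vanishing at `x`, whose `Xᵢ`-derivative does NOT vanish at `x` (a relation of least `Xᵢ`-degree). -/
theorem exists_relation (x : ι → ℂ) {s : Set ι} {i : ι}
    (hs : AlgebraicIndepOn ℚ x s) (hi : ¬ AlgebraicIndepOn ℚ x (insert i s)) :
    ∃ q : MvPolynomial ι ℚ, aeval x q = 0 ∧ ↑q.vars ⊆ insert i s ∧ aeval x (pderiv i q) ≠ 0 := by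
  classical
  have hex : ∃ q : MvPolynomial ι ℚ, q ≠ 0 ∧ aeval x q = 0 ∧ ↑q.vars ⊆ insert i s := by
    rw [AlgebraicIndepOn, algebraicIndependent_iff] at hi
    push Not at hi
    obtain ⟨p, hp0, hpne⟩ := hi
    refine ⟨rename ((↑) : ↥(insert i s) → ι) p, ?_, ?_, ?_⟩
    · intro h
      exact hpne (rename_injective _ Subtype.val_injective (by rw [h, map_zero]))
    · rw [aeval_rename]; exact hp0
    · intro v hv
      obtain ⟨w, -, rfl⟩ := Finset.mem_image.1 (vars_rename _ _ (Finset.mem_coe.1 hv))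
      exact w.2
  have hexd : ∃ d, ∃ q : MvPolynomial ι ℚ, q ≠ 0 ∧ aeval x q = 0 ∧ ↑q.vars ⊆ insert i s ∧ q.degreeOf i = d := by
    obtain ⟨q, h1, h2, h3⟩ := hex
    exact ⟨_, q, h1, h2, h3, rfl⟩
  obtain ⟨q, hq0, hqx, hqv, hqd⟩ := Nat.find_spec hexd
  have hmin : ∀ q' : MvPolynomial ι ℚ, q' ≠ 0 → aeval x q' = 0 → ↑q'.vars ⊆ insert i s →
      q.degreeOf i ≤ q'.degreeOf i :=
    fun q' h1 h2 h3 => hqd ▸ Nat.find_min' hexd ⟨q', h1, h2, h3, rfl⟩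
  refine ⟨q, hqx, hqv, fun hder => ?_⟩
  by_cases hpd : pderiv i q = 0
  · have hiv : i ∉ q.vars := Literature.Algebra.Polynomial.JacobianCriterion.notMem_vars_of_pderiv_eq_zero hpd
    have hqs : (↑q.vars : Set ι) ⊆ Set.range ((↑) : s → ι) := by
      intro v hv
      rcases hqv hv with h | h
      · exact absurd hv (h ▸ hiv)
      · exact ⟨⟨v, h⟩, rfl⟩
    obtain ⟨q', rfl⟩ := exists_rename_eq_of_vars_subset_range q ((↑) : s → ι) Subtype.val_injective hqs
    rw [aeval_rename] at hqx
    have h0 : q' = 0 := (algebraicIndependent_iff.1 hs) q' hqx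
    exact hq0 (by rw [h0, map_zero])
  · have h1 : (↑(pderiv i q).vars : Set ι) ⊆ insert i s :=
      fun v hv => hqv (Finset.mem_coe.2 (vars_pderiv_subset (Finset.mem_coe.1 hv)))
    exact absurd (hmin _ hpd hder h1) (not_le.2 (degreeOf_pderiv_lt hpd))

/-- Triangular families of vectors are linearly independent. -/
theorem linearIndependent_of_triangular {κ : Type*} [Fintype κ] (e : κ → ι)
    (v : κ → ι → ℂ) (hdiag : ∀ k, v k (e k) ≠ 0) (hoff : ∀ k k', k ≠ k' → v k (e k') = 0) :
    LinearIndependent ℂ v := by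
  rw [Fintype.linearIndependent_iff]
  intro g hg k
  have hk := congr_fun hg (e k)
  simp only [Finset.sum_apply, Pi.smul_apply, smul_eq_mul, Pi.zero_apply] at hk
  rw [Finset.sum_eq_single k (fun k' _ hk' => by rw [hoff k' k hk', mul_zero])
    (fun h => absurd (Finset.mem_univ k) h)] at hk
  exact (mul_eq_zero.1 hk).resolve_right (hdiag k)

/-- Clearing denominators: a rational polynomial is an integer polynomial up to a non-zero integer homothety. -/
theorem exists_int_multiple (q : MvPolynomial ι ℚ) :
    ∃ (D : ℤ) (p : MvPolynomial ι ℤ), D ≠ 0 ∧ map (algebraMap ℤ ℚ) p = C (D : ℚ) * q := by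
  classical
  induction q using MvPolynomial.induction_on' with
  | monomial m a =>
    refine ⟨a.den, monomial m a.num, by exact_mod_cast a.den_nz, ?_⟩
    rw [map_monomial, C_mul_monomial]
    congr 1
    simp [Rat.den_mul_eq_num]
  | add p₁ p₂ h₁ h₂ =>
    obtain ⟨D₁, r₁, hD₁, hr₁⟩ := h₁
    obtain ⟨D₂, r₂, hD₂, hr₂⟩ := h₂
    refine ⟨D₁ * D₂, C D₂ * r₁ + C D₁ * r₂, mul_ne_zero hD₁ hD₂, ?_⟩
    simp only [map_add, map_mul, map_C, hr₁, hr₂, Int.cast_mul, mul_add]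
    simp only [eq_intCast]
    ring

variable [Fintype ι] [DecidableEq ι]

/-- A maximal-cardinality algebraically independent set of coordinates exists (finitely many coordinates). -/
theorem exists_maxIndep (x : ι → ℂ) :
    ∃ s : Finset ι, AlgebraicIndepOn ℚ x ↑s ∧ ∀ i ∉ s, ¬ AlgebraicIndepOn ℚ x (insert i ↑s) := by
  classical
  let S : Finset (Finset ι) := Finset.univ.filter fun s => AlgebraicIndepOn ℚ x ↑s
  have hS : S.Nonempty := by
    refine ⟨∅, Finset.mem_filter.2 ⟨Finset.mem_univ _, ?_⟩⟩
    rw [AlgebraicIndepOn, Finset.coe_empty]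
    exact (algebraicIndependent_empty_type_iff).2 (algebraMap ℚ ℂ).injective
  obtain ⟨s, hsS, hmax⟩ := Finset.exists_max_image S Finset.card hS
  refine ⟨s, (Finset.mem_filter.1 hsS).2, fun i hi hins => ?_⟩
  have hmem : insert i s ∈ S := Finset.mem_filter.2 ⟨Finset.mem_univ _, by rwa [Finset.coe_insert]⟩
  have := hmax _ hmem
  rw [Finset.card_insert_of_notMem hi] at this
  omega

omit [Fintype ι] [DecidableEq ι] in
/-- An algebraically independent set of coordinates is no larger than the transcendence degree of any intermediate field
containing the coordinates. -/
theorem card_le_of_indep (x : ι → ℂ) (F : IntermediateField ℚ ℂ) (hxF : ∀ i, x i ∈ F) {s : Finset ι}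
    (hs : AlgebraicIndepOn ℚ x ↑s) : (s.card : Cardinal) ≤ Algebra.trdeg ℚ F := by
  let xF : ↥(↑s : Set ι) → F := fun j => ⟨x j, hxF j⟩
  have hind : AlgebraicIndependent ℚ xF := AlgebraicIndependent.of_comp F.val hs
  have h := hind.cardinalMk_le_trdeg
  simp only [Finset.coe_sort_coe, Cardinal.mk_fintype, Fintype.card_coe] at h
  exact h

/-- Transverse relations off a maximal independent set of coordinates. -/
theorem exists_relations (x : ι → ℂ) (F : IntermediateField ℚ ℂ) (hxF : ∀ i, x i ∈ F) {t : ℕ}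
    (ht : Algebra.trdeg ℚ F ≤ (t : Cardinal)) :
    ∃ s : Finset ι, s.card ≤ t ∧ ∃ q : ι → MvPolynomial ι ℚ,
      (∀ i ∉ s, aeval x (q i) = 0) ∧ (∀ i ∉ s, aeval x (pderiv i (q i)) ≠ 0) ∧
      (∀ i ∉ s, ∀ j ∉ s, j ≠ i → pderiv j (q i) = 0) := by
  classical
  obtain ⟨s, hs, hmax⟩ := exists_maxIndep x
  have hcard : s.card ≤ t := by exact_mod_cast (card_le_of_indep x F hxF hs).trans ht
  have hrel : ∀ i, ∃ q : MvPolynomial ι ℚ, i ∉ s →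
      (aeval x q = 0 ∧ ↑q.vars ⊆ insert i (↑s : Set ι) ∧ aeval x (pderiv i q) ≠ 0) := by
    intro i
    by_cases hi : i ∈ s
    · exact ⟨0, fun h => absurd hi h⟩
    · obtain ⟨q, h1, h2, h3⟩ := exists_relation x hs (hmax i hi)
      exact ⟨q, fun _ => ⟨h1, h2, h3⟩⟩
  choose q hq using hrel
  refine ⟨s, hcard, q, fun i hi => (hq i hi).1, fun i hi => (hq i hi).2.2, fun i hi j hj hji => ?_⟩
  apply pderiv_eq_zero_of_notMem_vars
  intro hjv
  rcases (hq i hi).2.1 (Finset.mem_coe.2 hjv) with h | h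
  · exact hji h
  · exact hj h

/-- **The certificate theorem (rational form).** A point `x ∈ ℂ^ι` whose coordinates lie in an intermediate field of
transcendence degree `≤ t` carries `r` rational relations with `ℂ`-linearly independent gradients whenever `r + t ≤ |ι|`. -/
theorem exists_certificate_rat (x : ι → ℂ) (F : IntermediateField ℚ ℂ) (hxF : ∀ i, x i ∈ F) {t r : ℕ}
    (ht : Algebra.trdeg ℚ F ≤ (t : Cardinal)) (hr : r + t ≤ Fintype.card ι) :
    ∃ P : Fin r → MvPolynomial ι ℚ, (∀ k, aeval x (P k) = 0) ∧
      LinearIndependent ℂ (fun k => fun j : ι => aeval x (pderiv j (P k))) := by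
  classical
  obtain ⟨s, hcard, q, hq0, hqd, hqoff⟩ := exists_relations x F hxF ht
  have hcompl : r ≤ Fintype.card {i // i ∉ s} := by
    rw [Fintype.card_subtype_compl, Fintype.card_coe]
    omega
  obtain ⟨e⟩ : Nonempty (Fin r ↪ {i // i ∉ s}) :=
    Function.Embedding.nonempty_of_card_le (by rwa [Fintype.card_fin])
  refine ⟨fun k => q (e k), fun k => hq0 _ (e k).2, ?_⟩
  have hli : LinearIndependent ℂ (fun k : {i // i ∉ s} => fun j : ι => aeval x (pderiv j (q k))) := by
    refine linearIndependent_of_triangular (fun k : {i // i ∉ s} => (k : ι)) _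
      (fun k : {i // i ∉ s} => hqd _ k.2) ?_
    intro k k' hkk'
    show aeval x (pderiv (k' : ι) (q k)) = 0
    rw [hqoff _ k.2 _ k'.2 (fun h => hkk' (Subtype.ext h.symm)), map_zero]
  exact hli.comp e e.injective

/-- **The certificate theorem (integer form).** A point `x ∈ ℂ^ι` whose coordinates lie in an intermediate field of
transcendence degree `≤ t` carries `r` INTEGER relations with `ℂ`-linearly independent gradients whenever `r + t ≤ |ι|`. -/
theorem exists_certificate (x : ι → ℂ) (F : IntermediateField ℚ ℂ) (hxF : ∀ i, x i ∈ F) {t r : ℕ}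
    (ht : Algebra.trdeg ℚ F ≤ (t : Cardinal)) (hr : r + t ≤ Fintype.card ι) :
    ∃ P : Fin r → MvPolynomial ι ℤ, (∀ k, aeval x (P k) = 0) ∧
      LinearIndependent ℂ (fun k => fun j : ι => aeval x (pderiv j (P k))) := by
  classical
  obtain ⟨Q, hQ0, hQli⟩ := exists_certificate_rat x F hxF ht hr
  have hcl : ∀ k, ∃ (D : ℤ) (p : MvPolynomial ι ℤ), D ≠ 0 ∧ map (algebraMap ℤ ℚ) p = C (D : ℚ) * Q k :=
    fun k => exists_int_multiple (Q k)
  choose D P hD hP using hcl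
  have haeval : ∀ p : MvPolynomial ι ℤ, aeval x p = aeval x (map (algebraMap ℤ ℚ) p) :=
    fun p => (aeval_map_algebraMap ℚ x p).symm
  refine ⟨P, fun k => ?_, ?_⟩
  · rw [haeval, hP, map_mul, hQ0, mul_zero]
  · have hpt : ∀ k j, aeval x (pderiv j (P k)) = (D k : ℂ) * aeval x (pderiv j (Q k)) := by
      intro k j
      rw [haeval, ← pderiv_map, hP, pderiv_C_mul, map_mul, algHom_C, map_intCast]
    let w : Fin r → ℂˣ := fun k => Units.mk0 (D k : ℂ) (by exact_mod_cast hD k)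
    convert hQli.units_smul w using 1
    funext k j
    rw [Pi.smul_apply', Pi.smul_apply, Units.smul_def, smul_eq_mul, hpt]
    rfl

end Certificate

/-! ## 2. Certificates at counterexamples; the certificate gauge -/

variable {n : ℕ}

/-- `P = (P₀, …, P_n)` is a TRANSVERSE INTEGER CERTIFICATE at `y`: `n + 1` integer relations on `(y, e^y)` with
`ℂ`-linearly independent gradients (verbatim the last two conjuncts of the conclusion of `BridgeTransverse` / `FinCS`). -/
def IsCertificate (n : ℕ) (y : Fin n → ℂ) (P : Fin (n + 1) → MvPolynomial (Fin n ⊕ Fin n) ℤ) : Prop :=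
  (∀ i, MvPolynomial.aeval (Sum.elim y (Complex.exp ∘ y)) (P i) = 0) ∧
    LinearIndependent ℂ (fun i => fun s : Fin n ⊕ Fin n =>
      MvPolynomial.aeval (Sum.elim y (Complex.exp ∘ y)) (MvPolynomial.pderiv s (P i)))

/-- The SIZE of an integer polynomial: the larger of its total degree and its height (verbatim the measure of the items). -/
def psize {σ : Type*} (P : MvPolynomial σ ℤ) : ℕ := max P.totalDegree (P.support.sup fun m => (P.coeff m).natAbs)

/-- **Every tuple of small transcendence degree carries a transverse integer certificate** (`trdeg ℚ(y, e^y) < n`; §1 with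
`ι = Fin n ⊕ Fin n`, `t = n − 1`, `r = n + 1`). -/
theorem exists_certificate_of_trdeg_lt {y : Fin n → ℂ}
    (hlt : Algebra.trdeg ℚ ↥(IntermediateField.adjoin ℚ (range y ∪ range (cexp ∘ y))) < (n : Cardinal)) :
    ∃ P, IsCertificate n y P := by
  classical
  set F := IntermediateField.adjoin ℚ (range y ∪ range (cexp ∘ y)) with hF
  have hxF : ∀ i, Sum.elim y (cexp ∘ y) i ∈ F := by
    rintro (j | j)
    · exact IntermediateField.subset_adjoin _ _ (Or.inl ⟨j, rfl⟩)
    · exact IntermediateField.subset_adjoin _ _ (Or.inr ⟨j, rfl⟩)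
  obtain ⟨k, hk⟩ := Cardinal.lt_aleph0.1 (hlt.trans (Cardinal.natCast_lt_aleph0 (n := n)))
  have hkn : k < n := by rw [hk] at hlt; exact_mod_cast hlt
  obtain ⟨t, rfl⟩ : ∃ t, n = t + 1 := ⟨n - 1, by omega⟩
  have hle : Algebra.trdeg ℚ F ≤ (t : Cardinal) := by rw [hk]; exact_mod_cast (by omega : k ≤ t)
  obtain ⟨P, hP0, hPli⟩ := exists_certificate (Sum.elim y (cexp ∘ y)) F hxF hle (r := t + 1 + 1)
    (by rw [Fintype.card_sum, Fintype.card_fin]; omega)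
  exact ⟨P, hP0, hPli⟩

/-- **Every counterexample carries a transverse integer certificate.** -/
theorem exists_certificate_of_counterEx {y : Fin n → ℂ} (hce : CounterEx y) : ∃ P, IsCertificate n y P :=
  exists_certificate_of_trdeg_lt hce.2

/-- The CERTIFICATE GAUGE `N(y)`: the least size of a transverse integer certificate at `y` (`0` if there is none). -/
def certGauge (n : ℕ) (y : Fin n → ℂ) : ℕ := sInf {N | ∃ P, (∀ i, psize (P i) ≤ N) ∧ IsCertificate n y P}

/-- A certificate of size `≤ N` bounds the gauge. -/
theorem certGauge_le {y : Fin n → ℂ} {P : Fin (n + 1) → MvPolynomial (Fin n ⊕ Fin n) ℤ} {N : ℕ}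
    (hP : IsCertificate n y P) (hN : ∀ i, psize (P i) ≤ N) : certGauge n y ≤ N :=
  Nat.sInf_le ⟨P, hN, hP⟩

/-- If a certificate exists, one of size `≤ certGauge n y` exists. -/
theorem certGauge_spec {y : Fin n → ℂ} (h : ∃ P, IsCertificate n y P) :
    ∃ P, (∀ i, psize (P i) ≤ certGauge n y) ∧ IsCertificate n y P := by
  obtain ⟨P, hP⟩ := h
  have hne : {N | ∃ P, (∀ i, psize (P i) ≤ N) ∧ IsCertificate n y P}.Nonempty :=
    ⟨Finset.univ.sup fun i => psize (P i), P, fun i => Finset.le_sup (f := fun i => psize (P i)) (Finset.mem_univ i), hP⟩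
  exact Nat.sInf_mem hne

/-- At a counterexample the certificate gauge is ATTAINED. -/
theorem certGauge_spec_of_counterEx {y : Fin n → ℂ} (hce : CounterEx y) :
    ∃ P, (∀ i, psize (P i) ≤ certGauge n y) ∧ IsCertificate n y P :=
  certGauge_spec (exists_certificate_of_counterEx hce)


end Summit.Schanuel.Schanuel.Theorems.RootDecomp1HGauge
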